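import Summits.Ventures.LatticeQCDFlow.Exactness.UniformWindowMetropolisSiteAcceptance
import HarnessLib

/-!
# The window law's two regimes: `1 − 2D/√(2π) ≤ ā ≤ 2φ(0)/D = 2/(D√(2π))`, `D = δ/(2√a)`

HONEST FRAMING: exact (Metropolis-corrected) sampling algorithms for lattice gauge theory;
figures of merit are autocorrelation/cost numbers at stated couplings and volumes; no
continuum-physics claim.  (SCALAR calibration rung S0-A: not a gauge result.)

Venture `LatticeQCDFlow` (cell pub-lqcd), topic `Exactness`; FANOUT row 2 (`s0-phi4`, LOCAL arm).  NEW
WORK of the cell — the elementary envelope of the exact law of `UniformWindowMetropolisSiteAcceptance`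
(`ā = 2Φ̄(D) + (2/D)(φ(0) − φ(D))`, uniform window of half-width `δ` on a Gaussian mode `N(0,a)`),
from `φ ≤ φ(0)` and Gordon's inequality `DΦ̄(D) ≤ φ(D)` (the tree's Literature
`GaussianTail.mul_tail_le_pdf`, `…/HeavyTails/LogNormalTailHillTarget`).  Nothing is cited as a fact
here; no definition.

* `gaussianTail_zero` — `Φ̄(0) = ½`; `gaussianTail_ge_half_sub` — `Φ̄(D) ≥ ½ − D·φ(0)` (`D ≥ 0`);
* **`windowSite_meanAccept_ge`** — `ā ≥ 1 − 2D·φ(0) = 1 − δ/(√(2π)·√a)`: the small-window deficit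
  is at most linear in `δ/σ`;
* **`windowSite_meanAccept_le`** — `ā ≤ 2φ(0)/D = 4√a·φ(0)/δ` (wide windows are accepted with
  probability `O(σ/δ)`, constant `4/√(2π)`).

NOT CLAIMED: sharpness of either constant; `λ > 0`; any value for any run.
-/

namespace Summit.Ventures.LatticeQCDFlow.Exactness

open Real MeasureTheory ProbabilityTheory Filter Set
open scoped NNReal ENNReal

section WindowBounds

variable {a : ℝ≥0} {δ : ℝ}

/-- `Φ̄(0) = ½` (reflection symmetry of `N(0,1)`, no atom at `0`). -/
theorem gaussianTail_zero : (gaussianReal (0 : ℝ) 1).real (Ioi 0) = 1 / 2 := by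
  haveI := nullSingletonClass_gaussianReal (μ := (0 : ℝ)) (v := 1) one_ne_zero
  have hsymm : (gaussianReal (0 : ℝ) 1).map (fun y => -y) = gaussianReal 0 1 := by
    rw [gaussianReal_map_neg, neg_zero]
  have h1 : (gaussianReal (0 : ℝ) 1).real (Iio 0) = (gaussianReal (0 : ℝ) 1).real (Ioi 0) := by
    conv_lhs => rw [← hsymm]
    rw [map_measureReal_apply measurable_neg measurableSet_Iio]
    congr 1; ext y; simp
  have h2 : (gaussianReal (0 : ℝ) 1).real (Iio 0) + (gaussianReal (0 : ℝ) 1).real (Ici 0) = 1 := by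
    rw [← measureReal_union (Set.disjoint_left.mpr fun x hx hx' => (not_le.mpr (mem_Iio.mp hx)) (mem_Ici.mp hx'))
      measurableSet_Ici, Iio_union_Ici, probReal_univ]
  have h3 : (gaussianReal (0 : ℝ) 1).real (Ici 0) = (gaussianReal (0 : ℝ) 1).real (Ioi 0) :=
    measureReal_congr Ioi_ae_eq_Ici.symm
  linarith

/-- `Φ̄(D) ≥ ½ − D·φ(0)` for `D ≥ 0` (`Φ̄(0) − Φ̄(D) = ∫₀^D φ ≤ D·φ(0)`). -/
theorem gaussianTail_ge_half_sub {D : ℝ} (hD : 0 ≤ D) :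
    1 / 2 - D * gaussianPDFReal 0 1 0 ≤ (gaussianReal (0 : ℝ) 1).real (Ioi D) := by
  have h := Literature.Probability.HeavyTails.GaussianTail.tail_eq_tail_sub_intervalIntegral 0 D
  rw [gaussianTail_zero] at h
  have hle : ∫ y in (0 : ℝ)..D, gaussianPDFReal 0 1 y ≤ ∫ _ in (0 : ℝ)..D, gaussianPDFReal 0 1 0 := by
    refine intervalIntegral.integral_mono_on hD
      (Literature.Probability.HeavyTails.GaussianTail.continuous_pdf.intervalIntegrable _ _)
      intervalIntegrable_const (fun y _ => ?_)
    simp only [gaussianPDFReal_def, NNReal.coe_one, mul_one, sub_zero, ne_eq, OfNat.ofNat_ne_zero,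
      not_false_eq_true, zero_pow, neg_zero, zero_div, Real.exp_zero]
    exact mul_le_of_le_one_right (inv_nonneg.mpr (Real.sqrt_nonneg _))
      (by rw [← Real.exp_zero]; exact Real.exp_le_exp.mpr (by nlinarith [sq_nonneg y]))
  rw [intervalIntegral.integral_const, smul_eq_mul, sub_zero] at hle
  rw [h]
  linarith

/-- `φ(D) ≤ φ(0)` (private twin of `Scoring/GaussianShiftedBallLipschitz.gaussianPDFReal_std_le_zero`). -/
private theorem gaussianPDF_le_at_zero (D : ℝ) : gaussianPDFReal 0 1 D ≤ gaussianPDFReal 0 1 0 := by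
  simp only [gaussianPDFReal_def, NNReal.coe_one, mul_one, sub_zero, ne_eq, OfNat.ofNat_ne_zero,
    not_false_eq_true, zero_pow, neg_zero, zero_div, Real.exp_zero]
  exact mul_le_of_le_one_right (inv_nonneg.mpr (Real.sqrt_nonneg _))
    (by rw [← Real.exp_zero]; exact Real.exp_le_exp.mpr (by nlinarith [sq_nonneg D]))

/-- **SMALL WINDOWS**: `ā ≥ 1 − 2D·φ(0)`, `D = δ/(2√a)` (normalised form). -/
theorem windowSite_meanAccept_ge (ha : a ≠ 0) (hδ : 0 < δ) :
    1 - 2 * (δ / (2 * Real.sqrt a)) * gaussianPDFReal 0 1 0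
      ≤ (∫ p : ℝ × ℝ, min 1 (Real.exp (-(p.1 * (2 * p.2 + p.1) / (2 * a)))) * gaussianPDFReal 0 a p.2
          ∂(((volume : Measure ℝ).restrict (Icc (-δ) δ)).prod (volume : Measure ℝ))) / (2 * δ) := by
  have ha' : (0 : ℝ) < a := by exact_mod_cast pos_iff_ne_zero.mpr ha
  have hsa : 0 < Real.sqrt (a : ℝ) := Real.sqrt_pos.mpr ha'
  have hD : 0 < δ / (2 * Real.sqrt a) := by positivity
  rw [windowSite_meanAccept_normalised ha hδ]
  have h1 := gaussianTail_ge_half_sub hD.le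
  have h2 := gaussianPDF_le_at_zero (δ / (2 * Real.sqrt a))
  have h3 : 0 ≤ 2 / (δ / (2 * Real.sqrt a)) * (gaussianPDFReal 0 1 0 - gaussianPDFReal 0 1 (δ / (2 * Real.sqrt a))) :=
    mul_nonneg (by positivity) (by linarith)
  linarith

/-- **WIDE WINDOWS**: `ā ≤ 2φ(0)/D` (Gordon's `DΦ̄(D) ≤ φ(D)`). -/
theorem windowSite_meanAccept_le (ha : a ≠ 0) (hδ : 0 < δ) :
    (∫ p : ℝ × ℝ, min 1 (Real.exp (-(p.1 * (2 * p.2 + p.1) / (2 * a)))) * gaussianPDFReal 0 a p.2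
        ∂(((volume : Measure ℝ).restrict (Icc (-δ) δ)).prod (volume : Measure ℝ))) / (2 * δ)
      ≤ 2 * gaussianPDFReal 0 1 0 / (δ / (2 * Real.sqrt a)) := by
  have ha' : (0 : ℝ) < a := by exact_mod_cast pos_iff_ne_zero.mpr ha
  have hsa : 0 < Real.sqrt (a : ℝ) := Real.sqrt_pos.mpr ha'
  set D : ℝ := δ / (2 * Real.sqrt a) with hDdef
  have hD : 0 < D := by rw [hDdef]; positivity
  rw [windowSite_meanAccept_normalised ha hδ]
  have hg := Literature.Probability.HeavyTails.GaussianTail.mul_tail_le_pdf D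
  -- `2Φ̄(D) ≤ (2/D)φ(D)`
  have h1 : 2 * (gaussianReal (0 : ℝ) 1).real (Ioi D) ≤ 2 / D * gaussianPDFReal 0 1 D := by
    rw [div_mul_eq_mul_div, le_div_iff₀ hD]
    nlinarith
  have h2 : 2 / D * (gaussianPDFReal 0 1 0 - gaussianPDFReal 0 1 D) = 2 * gaussianPDFReal 0 1 0 / D - 2 / D * gaussianPDFReal 0 1 D := by
    ring
  rw [h2]
  linarith

end WindowBounds

end Summit.Ventures.LatticeQCDFlow.Exactness
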